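import Mathlib.Analysis.SpecialFunctions.SmoothTransition
import Literature.Analysis.FluidPDE.StirringCellCalculus
import Literature.Analysis.FunctionSpaces.TorusPlantingTools
import Literature.Analysis.FunctionSpaces.TorusSpaceTime
import Literature.Analysis.FunctionSpaces.TorusSpaceTimeCutoff
import Literature.Analysis.FluidPDE.EulerReynolds
import Literature.Analysis.FluidPDE.TorusClassicalLerayHopfProofs
import HarnessLib

/-!
# Solo refutation — C173 `Tibola2025`, PART A: the witness family (no skeleton import)

D-0090 «where NS proofs break» map, cell `ns-claims`; refuter of record ns-claims-refuter-6 g5. A TIME-SWITCHED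
COMPACTLY SUPPORTED DIVERGENCE-FREE BUMP on `ℝ × 𝕋³`: `u(t, x) = S(t − s) · V_δ(x)`, `S = Real.smoothTransition`
(`0` for `t ≤ s`, `> 0` after), `V_δ = periodize (∂₁ψ e₀ − ∂₀ψ e₁)`, `ψ(y) = S(2(1 − |y − q|²/δ²))` a smooth bump
of radius `δ < 1/2` about `q = (½, ½, ½)` (`V_δ` is `C^∞`, divergence-free, `≢ 0`, zero at torus distance `> δ`
from `proj q`); pressure `p ≡ 0`; force `f := ∂ₜu + (u·∇)u − νΔu = S′V + S²(V·∇)V − νSΔV` (jointly smooth): a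
classical solution of the FORCED Navier–Stokes system on all of `ℝ × 𝕋³` (`Torus.IsClassicalNSSolutionOn univ`),
hence a global Leray–Hopf solution by the tree. Mass bookkeeping in `ℝ≥0∞`: for `G 0 = 0` the integral of `G ∘ u`
over a cylinder `(a, t₀) × B_R(proj q)` is the same for all `a ≤ s`, `R > δ` (`setLIntegral_cyl_eq`), positive once
`s < t₀`, finite. PART B (`SoloRefuteTibola2025`) imports this file and the skeleton `Literature.Claims.NS.Tibola2025`
and kills `Step_L1220` / the seam `Step_L1220_of`. WHAT THIS IS NOT: not a claim about NS regularity or blow-up;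
not a claim about any author beyond the typed locator.
[cite: Tibola2025] [cite: CaffarelliKohnNirenberg1982, §2 (the scale-invariant quantities)]
-/

set_option linter.dupNamespace false

noncomputable section
open Set Function Metric MeasureTheory
open scoped ContDiff ENNReal
namespace Summit.NavierStokesRegularity.NavierStokesRegularity.Theorems.Tibola2025

open Literature.Analysis.FunctionSpaces Literature.Analysis.FunctionSpaces.Torus

/-- `ℝ³` (velocity values). -/
abbrev E3 : Type := EuclideanSpace ℝ (Fin 3)
/-- The flat three-torus `𝕋³`. -/
abbrev T3 : Type := UnitAddTorus (Fin 3)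




/-- The standard orthonormal frame of `ℝ³`. -/
def b : OrthonormalBasis (Fin 3) ℝ E3 := EuclideanSpace.basisFun (Fin 3) ℝ

/-- Centre of the fundamental cube. -/
def qc : E3 := WithLp.toLp 2 fun _ => (1 / 2 : ℝ)

/-- Coordinates of the cube centre. [folklore] -/
theorem qc_apply (i : Fin 3) : qc i = 1 / 2 := rfl

/-- Scalar bump of radius `δ` about the cube centre: `ψ(y) = S(2(1 - |y - q|²/δ²))`,
`S` = `Real.smoothTransition`. -/
def ψ (δ : ℝ) (y : E3) : ℝ := Real.smoothTransition (2 * (1 - ‖y - qc‖ ^ 2 / δ ^ 2))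

/-- The planar divergence-free field `W = ∂₁ψ e₀ − ∂₀ψ e₁`. -/
def W (δ : ℝ) : E3 → E3 := fun y => (fderiv ℝ (ψ δ) y (b 1)) • b 0 - (fderiv ℝ (ψ δ) y (b 0)) • b 1

/-- Unfolding lemma for `W` (the `planarField` shape of `StirringCellCalculus`). [folklore] -/
theorem W_def (δ : ℝ) :
    W δ = fun y => (fderiv ℝ (ψ δ) y (b 1)) • b 0 - (fderiv ℝ (ψ δ) y (b 0)) • b 1 := rfl

variable {δ : ℝ}

/-- `ψ` is smooth (Mathlib `Real.smoothTransition.contDiff`). [folklore] -/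
theorem contDiff_ψ (δ : ℝ) : ContDiff ℝ ∞ (ψ δ) := by
  unfold ψ
  refine Real.smoothTransition.contDiff.comp ?_
  refine contDiff_const.mul (contDiff_const.sub ?_)
  exact ((contDiff_id.sub contDiff_const).norm_sq ℝ).div_const _

/-- `ψ` vanishes outside the ball of radius `δ` about the centre. [folklore] -/
theorem ψ_eq_zero_of_le (hδ : 0 < δ) {y : E3} (hy : δ ≤ ‖y - qc‖) : ψ δ y = 0 := by
  unfold ψ
  apply Real.smoothTransition.zero_of_nonpos
  have h1 : δ ^ 2 ≤ ‖y - qc‖ ^ 2 := pow_le_pow_left₀ hδ.le hy 2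
  have h2 : 1 ≤ ‖y - qc‖ ^ 2 / δ ^ 2 := by
    rw [le_div_iff₀ (by positivity)]; linarith
  linarith

/-- The topological support of `ψ` lies in the closed `δ`-ball about the centre. [folklore] -/
theorem tsupport_ψ_subset (hδ : 0 < δ) : tsupport (ψ δ) ⊆ closedBall qc δ := by
  refine closure_minimal (fun y hy => ?_) isClosed_closedBall
  rw [mem_closedBall, dist_eq_norm]
  by_contra h
  exact hy (ψ_eq_zero_of_le hδ (not_le.1 h).le)

/-- `ψ = 1` at the centre. [folklore] -/
theorem ψ_qc (δ : ℝ) : ψ δ qc = 1 := by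
  unfold ψ
  apply Real.smoothTransition.one_of_one_le
  simp

/-- `ψ = 0` on the sphere of radius `δ` (at `q + δe₀`). [folklore] -/
theorem ψ_edge (hδ : 0 < δ) : ψ δ (qc + δ • b 0) = 0 := by
  apply ψ_eq_zero_of_le hδ
  simp [b, norm_smul, abs_of_pos hδ]

/-- `W` is smooth. [folklore] -/
theorem contDiff_W (δ : ℝ) : ContDiff ℝ ∞ (W δ) :=
  Literature.Analysis.FluidPDE.contDiff_planarField b (contDiff_ψ δ) (W_def δ)

/-- `W` vanishes off the closed `δ`-ball about the centre. [folklore] -/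
theorem W_eq_zero_of_not_mem (hδ : 0 < δ) {y : E3} (hy : y ∉ closedBall qc δ) : W δ y = 0 :=
  Literature.Analysis.FluidPDE.planarField_eq_zero_of_notMem_tsupport b (W_def δ) fun h =>
    hy (tsupport_ψ_subset hδ h)

/-- The topological support of `W` lies in the closed `δ`-ball about the centre. [folklore] -/
theorem tsupport_W_subset (hδ : 0 < δ) : tsupport (W δ) ⊆ closedBall qc δ :=
  (Literature.Analysis.FluidPDE.tsupport_planarField_subset b (W_def δ)).trans (tsupport_ψ_subset hδ)

/-- `W` is divergence-free (mixed partials commute). [folklore] -/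
theorem divergence_W (δ : ℝ) (y : E3) : Literature.Analysis.FluidPDE.VectorCalculus.divergence (W δ) y = 0 :=
  Literature.Analysis.FluidPDE.divergence_planarField b ((contDiff_ψ δ).of_le (by norm_cast)) (W_def δ) y

/-- `W` is not identically zero (mean value theorem along `e₀` between the centre and the edge). [folklore] -/
theorem exists_W_ne_zero (hδ : 0 < δ) : ∃ y, W δ y ≠ 0 := by
  refine Literature.Analysis.FluidPDE.exists_planarField_ne_zero b (i₀ := 0) (i₁ := 1) (by decide)
    ((contDiff_ψ δ).of_le (by norm_cast)) (W_def δ) (p := qc) (t₀ := δ) ?_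
  rw [ψ_edge hδ, ψ_qc]; norm_num

/-- The closed ball of radius `δ < 1/2` about the centre lies in the open unit cube. -/
theorem closedBall_subset_openCube (hδ' : δ < 1 / 2) :
    closedBall qc δ ⊆ {y : E3 | ∀ i, y i ∈ Ioo (0 : ℝ) 1} := by
  intro y hy i
  rw [mem_closedBall, dist_eq_norm] at hy
  have h1 : |(y - qc) i| ≤ ‖y - qc‖ := by
    have h := PiLp.norm_apply_le (y - qc) i
    rwa [Real.norm_eq_abs] at h
  rw [PiLp.sub_apply, qc_apply, abs_le] at h1
  constructor <;> linarith [h1.1, h1.2]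

/-- The torus field: periodisation of `W`. -/
def V (δ : ℝ) : T3 → E3 := periodize (W δ)

/-- `W` vanishes off the open unit cube (`δ < 1/2`). [folklore] -/
theorem W_eq_zero_of_not_openCube (hδ : 0 < δ) (hδ' : δ < 1 / 2) (y : E3)
    (hy : ¬ ∀ i, y i ∈ Ioo (0 : ℝ) 1) : W δ y = 0 :=
  W_eq_zero_of_not_mem hδ fun h => hy (closedBall_subset_openCube hδ' h)

/-- On the torus, `V` is `W` read in the fundamental cube. [folklore] -/
theorem V_apply (hδ : 0 < δ) (hδ' : δ < 1 / 2) (x : T3) : V δ x = W δ (repr x) :=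
  periodize_eq_apply_repr (W_eq_zero_of_not_openCube hδ hδ') x

/-- `V` is smooth. [folklore] -/
theorem isSmooth_V (hδ : 0 < δ) : IsSmooth (V δ) :=
  isSmooth_periodize (contDiff_W δ) (R := δ + ‖qc‖)
    ((tsupport_W_subset hδ).trans (closedBall_subset_closedBall' (by rw [dist_zero_right])))

/-- `V` is divergence-free. [folklore] -/
theorem isDivFree_V (hδ : 0 < δ) (hδ' : δ < 1 / 2) : IsDivFree (V δ) :=
  isDivFree_periodize_of_cube (contDiff_W δ) isClosed_closedBall (closedBall_subset_openCube hδ')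
    (fun _ hy => W_eq_zero_of_not_mem hδ hy) (fun z => divergence_W δ z)

/-- Where `V ≠ 0`, the cube representative is within `δ` of the centre. [folklore] -/
theorem norm_repr_sub_lt_of_V_ne_zero (hδ : 0 < δ) (hδ' : δ < 1 / 2) {x : T3} (hx : V δ x ≠ 0) :
    ‖repr x - qc‖ ≤ δ := by
  rw [V_apply hδ hδ' x] at hx
  by_contra h
  exact hx (W_eq_zero_of_not_mem hδ (by rwa [mem_closedBall, dist_eq_norm]))

/-- Points where `V ≠ 0` are within torus distance `δ` of the projected centre. -/
theorem dist_le_of_V_ne_zero (hδ : 0 < δ) (hδ' : δ < 1 / 2) {x : T3} (hx : V δ x ≠ 0) :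
    dist x (proj qc) ≤ δ := by
  have h := norm_repr_sub_lt_of_V_ne_zero hδ hδ' hx
  calc dist x (proj qc) = dist (proj (repr x)) (proj qc) := by rw [proj_repr]
    _ ≤ ‖repr x - qc‖ := dist_proj_proj_le _ _
    _ ≤ δ := h

/-- `V` is not identically zero. [folklore] -/
theorem exists_V_ne_zero (hδ : 0 < δ) (hδ' : δ < 1 / 2) : ∃ x, V δ x ≠ 0 := by
  obtain ⟨y, hy⟩ := exists_W_ne_zero hδ
  have hyK : y ∈ closedBall qc δ := by
    by_contra h; exact hy (W_eq_zero_of_not_mem hδ h)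
  have hyU : y ∈ unitCube (Fin 3) := fun i => Ioo_subset_Ico_self (closedBall_subset_openCube hδ' hyK i)
  refine ⟨proj y, ?_⟩
  rwa [V_apply hδ hδ', repr_proj_of_mem_unitCube_holds hyU]

/-! ## The time switch and the space–time field -/
/-- Smooth switch: `0` for `t ≤ s`, positive for `t > s`. -/
def sw (s t : ℝ) : ℝ := Real.smoothTransition (t - s)

/-- The switch is off up to time `s`. [folklore] -/
theorem sw_of_le {s t : ℝ} (h : t ≤ s) : sw s t = 0 :=
  Real.smoothTransition.zero_of_nonpos (by linarith)

/-- The switch is strictly positive after time `s`. [folklore] -/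
theorem sw_pos {s t : ℝ} (h : s < t) : 0 < sw s t :=
  Real.smoothTransition.pos_of_pos (by linarith)

/-- The switch is nonnegative. [folklore] -/
theorem sw_nonneg (s t : ℝ) : 0 ≤ sw s t := Real.smoothTransition.nonneg _

/-- The switch is smooth. [folklore] -/
theorem contDiff_sw (s : ℝ) : ContDiff ℝ ∞ (sw s) :=
  Real.smoothTransition.contDiff.comp (contDiff_id.sub contDiff_const)

/-- The velocity `u(t, x) = sw_s(t) V_δ(x)`. -/
def vel (δ s : ℝ) : ℝ → T3 → E3 := fun t x => sw s t • V δ x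

/-- The pressure: identically zero. -/
def pres : ℝ → T3 → ℝ := fun _ _ => 0

/-- The force, defined by the momentum equation. -/
def force (ν δ s : ℝ) : ℝ → T3 → E3 := fun t x =>
  Torus.timeDerivWithin univ (vel δ s) t x + convect (vel δ s t) (vel δ s t) x - ν • laplacian (vel δ s t) x

/-- The velocity is jointly smooth on every time set. [folklore] -/
theorem isSmoothSpaceTimeOn_vel (hδ : 0 < δ) (s : ℝ) (S : Set ℝ) : Torus.IsSmoothSpaceTimeOn S (vel δ s) := by
  have h : stLift (vel δ s) = fun p : ℝ × E3 => sw s p.1 • lift (V δ) p.2 := by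
    funext p; rfl
  unfold Torus.IsSmoothSpaceTimeOn
  rw [h]
  exact (((contDiff_sw s).comp contDiff_fst).smul ((isSmooth_V hδ).comp contDiff_snd)).contDiffOn

/-- **The witness is a classical forced Navier–Stokes solution on all of `ℝ × T³`** (pressure `0`, force := the momentum residual; incompressibility from `div V = 0`). [folklore] -/
theorem isClassicalNSSolutionOn_vel (ν : ℝ) (hδ : 0 < δ) (hδ' : δ < 1 / 2) (s : ℝ) :
    Torus.IsClassicalNSSolutionOn univ ν (force ν δ s) (vel δ s) pres where
  smooth_velocity := isSmoothSpaceTimeOn_vel hδ s univ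
  smooth_pressure := isSmoothSpaceTimeOn_const (isSmooth_const (0 : ℝ)) univ
  momentum := by
    intro t _ x
    have hg : Torus.gradient (pres t) x = 0 := Literature.Analysis.FluidPDE.Torus.gradient_zero x
    rw [hg, sub_zero]
    simp only [force]
    abel
  divFree := by
    intro t _ x
    have h : vel δ s t = sw s t • V δ := rfl
    rw [h, Literature.Analysis.FluidPDE.Torus.divergence_const_smul
      ((isSmooth_V hδ).isContDiff (mod_cast le_top)), isDivFree_V hδ hδ' x, mul_zero]

/-- The velocity vanishes up to the switch-on time `s`. [folklore] -/
theorem vel_eq_zero_of_le {s t : ℝ} (h : t ≤ s) (x : T3) : vel δ s t x = 0 := by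
  simp [vel, sw_of_le h]

/-- The velocity vanishes at torus distance `> δ` from the projected centre. [folklore] -/
theorem vel_eq_zero_of_dist {s t : ℝ} (hδ : 0 < δ) (hδ' : δ < 1 / 2) {x : T3} (hx : δ < dist x (proj qc)) :
    vel δ s t x = 0 := by
  have : V δ x = 0 := by
    by_contra h
    exact (not_le.2 hx) (dist_le_of_V_ne_zero hδ hδ' h)
  simp [vel, this]

/-- After the switch-on time the velocity is not identically zero. [folklore] -/
theorem exists_vel_ne_zero (hδ : 0 < δ) (hδ' : δ < 1 / 2) {s t : ℝ} (h : s < t) : ∃ x, vel δ s t x ≠ 0 := by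
  obtain ⟨x, hx⟩ := exists_V_ne_zero hδ hδ'
  exact ⟨x, by simpa [vel, (sw_pos h).ne'] using hx⟩

/-- Joint continuity of the velocity. [folklore] -/
theorem continuous_vel_uncurry (hδ : 0 < δ) (s : ℝ) : Continuous (uncurry (vel δ s)) :=
  ((contDiff_sw s).continuous.comp continuous_fst).smul ((isSmooth_V hδ).continuous.comp continuous_snd)


/-! ## Space–time cylinder masses (`ℝ≥0∞`) -/
/-- The space–time cylinder `(a, t₀) × B_R(x₀)`. -/
def cylST (a t₀ : ℝ) (x₀ : T3) (R : ℝ) : Set (ℝ × T3) := Ioo a t₀ ×ˢ ball x₀ R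

/-- Cylinders are measurable. [folklore] -/
theorem measurableSet_cyl (a t₀ : ℝ) (x₀ : T3) (R : ℝ) : MeasurableSet (cylST a t₀ x₀ R) :=
  measurableSet_Ioo.prod measurableSet_ball

/-- Two cylinders with the same top time `t₀`, both radii `> δ` and both bottoms `≤ s`, carry the
same space–time mass of any `G ∘ u` with `G 0 = 0`. -/
theorem setLIntegral_cyl_eq (hδ : 0 < δ) (hδ' : δ < 1 / 2) {s t₀ a a' R R' : ℝ} (ha : a ≤ s) (ha' : a' ≤ s)
    (hR : δ < R) (hR' : δ < R') (G : E3 → ℝ≥0∞) (hG : G 0 = 0) :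
    ∫⁻ q in cylST a t₀ (proj qc) R, G (vel δ s q.1 q.2) = ∫⁻ q in cylST a' t₀ (proj qc) R', G (vel δ s q.1 q.2) := by
  rw [← lintegral_indicator (measurableSet_cyl _ _ _ _), ← lintegral_indicator (measurableSet_cyl _ _ _ _)]
  congr 1
  funext q
  by_cases hq : G (vel δ s q.1 q.2) = 0
  · simp [Set.indicator, hq]
  · have h1 : s < q.1 := by
      by_contra h; exact hq (by rw [vel_eq_zero_of_le (not_lt.1 h), hG])
    have h2 : dist q.2 (proj qc) ≤ δ := by
      by_contra h; exact hq (by rw [vel_eq_zero_of_dist hδ hδ' (not_le.1 h), hG])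
    have hm : q ∈ cylST a t₀ (proj qc) R ↔ q ∈ cylST a' t₀ (proj qc) R' := by
      simp only [cylST, mem_prod, mem_Ioo, mem_ball]
      constructor
      · rintro ⟨⟨_, h3⟩, _⟩; exact ⟨⟨lt_of_le_of_lt ha' h1, h3⟩, lt_of_le_of_lt h2 hR'⟩
      · rintro ⟨⟨_, h3⟩, _⟩; exact ⟨⟨lt_of_le_of_lt ha h1, h3⟩, lt_of_le_of_lt h2 hR⟩
    by_cases hq1 : q ∈ cylST a t₀ (proj qc) R
    · simp [Set.indicator, hq1, hm.1 hq1]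
    · simp [Set.indicator, hq1, mt hm.2 hq1]

/-- Positivity of the cylinder mass: the cylinder above the switch-on time has positive mass. -/
theorem setLIntegral_cyl_pos (hδ : 0 < δ) (hδ' : δ < 1 / 2) {s t₀ a R : ℝ} (ha : a ≤ s) (hst : s < t₀)
    (hR : δ < R) (G : E3 → ℝ≥0∞) (hGm : Measurable G) (hGp : ∀ v, v ≠ 0 → G v ≠ 0) :
    0 < ∫⁻ q in cylST a t₀ (proj qc) R, G (vel δ s q.1 q.2) := by
  have hmeas : Measurable fun q : ℝ × T3 => G (vel δ s q.1 q.2) :=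
    hGm.comp (continuous_vel_uncurry hδ s).measurable
  rw [lintegral_pos_iff_support hmeas, Measure.restrict_apply' (measurableSet_cyl _ _ _ _)]
  -- the open set `(s, t₀) × {V ≠ 0}` lies in `support ∩ cylST`
  set O : Set (ℝ × T3) := Ioo s t₀ ×ˢ {x | V δ x ≠ 0} with hO
  have hOopen : IsOpen O := isOpen_Ioo.prod (isOpen_ne_fun (isSmooth_V hδ).continuous continuous_const)
  obtain ⟨x, hx⟩ := exists_V_ne_zero hδ hδ'
  have hOne : O.Nonempty := ⟨((s + t₀) / 2, x), ⟨⟨by linarith, by linarith⟩, hx⟩⟩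
  have hOsub : O ⊆ (support fun q : ℝ × T3 => G (vel δ s q.1 q.2)) ∩ cylST a t₀ (proj qc) R := by
    rintro ⟨t, y⟩ ⟨⟨h1, h2⟩, hy⟩
    refine ⟨?_, ⟨⟨lt_of_le_of_lt ha h1, h2⟩, ?_⟩⟩
    · exact hGp _ (by simpa [vel, (sw_pos h1).ne'] using hy)
    · exact lt_of_le_of_lt (dist_le_of_V_ne_zero hδ hδ' hy) hR
  exact lt_of_lt_of_le (hOopen.measure_pos volume hOne) (measure_mono hOsub)

/-- Finiteness of the cylinder mass for a continuous finite-valued `G`. -/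
theorem setLIntegral_cyl_lt_top (hδ : 0 < δ) {s t₀ a R : ℝ} (G : E3 → ℝ≥0∞) (hGc : Continuous G)
    (hGf : ∀ v, G v ≠ ⊤) : ∫⁻ q in cylST a t₀ (proj qc) R, G (vel δ s q.1 q.2) < ⊤ := by
  -- `G ∘ u` is bounded on the compact `[a, t₀] × T³`
  have hK : IsCompact (Icc a t₀ ×ˢ (univ : Set T3)) := isCompact_Icc.prod isCompact_univ
  have hc : Continuous fun q : ℝ × T3 => G (vel δ s q.1 q.2) := hGc.comp (continuous_vel_uncurry hδ s)
  obtain ⟨C, hCt, hC⟩ : ∃ C : ℝ≥0∞, C < ⊤ ∧ ∀ q ∈ Icc a t₀ ×ˢ (univ : Set T3), G (vel δ s q.1 q.2) ≤ C := by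
    by_cases hne : (Icc a t₀ ×ˢ (univ : Set T3)).Nonempty
    · obtain ⟨q₀, _, hq₀⟩ := hK.exists_isMaxOn hne hc.continuousOn
      exact ⟨G (vel δ s q₀.1 q₀.2), (hGf _).lt_top, fun q hq => hq₀ hq⟩
    · exact ⟨0, by simp, fun q hq => (hne ⟨q, hq⟩).elim⟩
  have hsub : cylST a t₀ (proj qc) R ⊆ Icc a t₀ ×ˢ (univ : Set T3) := by
    rintro ⟨t, y⟩ ⟨⟨h1, h2⟩, _⟩; exact ⟨⟨h1.le, h2.le⟩, mem_univ _⟩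
  calc ∫⁻ q in cylST a t₀ (proj qc) R, G (vel δ s q.1 q.2)
      ≤ ∫⁻ _ in cylST a t₀ (proj qc) R, C := setLIntegral_mono' (measurableSet_cyl _ _ _ _)
          fun q hq => hC q (hsub hq)
    _ = C * volume (cylST a t₀ (proj qc) R) := setLIntegral_const _ _
    _ ≤ C * volume (Icc a t₀ ×ˢ (univ : Set T3)) := by gcongr
    _ < ⊤ := by
        refine ENNReal.mul_lt_top hCt ?_
        rw [Measure.volume_eq_prod, Measure.prod_prod]
        exact ENNReal.mul_lt_top measure_Icc_lt_top (measure_lt_top _ _)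


/-! ## The force in closed form and its smoothness -/
/-- `∂ₜu = sw′(t) V`. [folklore] -/
theorem timeDerivWithin_vel (s t : ℝ) (x : T3) :
    Torus.timeDerivWithin univ (vel δ s) t x = deriv (sw s) t • V δ x := by
  unfold Torus.timeDerivWithin vel
  rw [derivWithin_univ]
  exact deriv_smul_const (((contDiff_sw s).differentiable (by simp)).differentiableAt) _

/-- `(u·∇)u = sw(t)² (V·∇)V`. [folklore] -/
theorem convect_vel (hδ : 0 < δ) (s t : ℝ) (x : T3) :
    convect (vel δ s t) (vel δ s t) x = (sw s t) ^ 2 • convect (V δ) (V δ) x := by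
  have h : vel δ s t = sw s t • V δ := rfl
  unfold convect
  rw [h, fderiv_const_smul ((isSmooth_V hδ).isContDiff (mod_cast le_top))]
  rw [show (sw s t • Torus.fderiv (V δ) x) ((sw s t • V δ) x) = sw s t • Torus.fderiv (V δ) x (sw s t • V δ x)
    from rfl, map_smul, smul_smul, sq]

/-- `Δu = sw(t) ΔV`. [folklore] -/
theorem laplacian_vel (hδ : 0 < δ) (s t : ℝ) (x : T3) :
    laplacian (vel δ s t) x = sw s t • laplacian (V δ) x := by
  have h : vel δ s t = sw s t • V δ := rfl
  have h2 : ContDiffAt ℝ 2 (liftAt (V δ) x) 0 :=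
    (((isSmooth_V hδ).liftAt x).of_le (WithTop.coe_le_coe.mpr le_top)).contDiffAt
  have hl : liftAt (sw s t • V δ) x = sw s t • liftAt (V δ) x := rfl
  simp only [h, Torus.laplacian, hl]
  exact InnerProductSpace.laplacian_smul _ h2

/-- Closed form of the force: `f = sw′ V + sw² (V·∇)V − ν sw ΔV`. [folklore] -/
theorem force_eq (ν : ℝ) (hδ : 0 < δ) (s : ℝ) :
    force ν δ s = fun t x => deriv (sw s) t • V δ x + (sw s t) ^ 2 • convect (V δ) (V δ) x
      - (ν * sw s t) • laplacian (V δ) x := by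
  funext t x
  rw [force, timeDerivWithin_vel, convect_vel hδ, laplacian_vel hδ, smul_smul]

/-- The force is jointly smooth on every time set. [folklore] -/
theorem isSmoothSpaceTimeOn_force (ν : ℝ) (hδ : 0 < δ) (s : ℝ) (S : Set ℝ) :
    Torus.IsSmoothSpaceTimeOn S (force ν δ s) := by
  rw [force_eq ν hδ s]
  apply isSmoothSpaceTimeOn_of_contDiff
  have hsw := contDiff_sw s
  have hd : ContDiff ℝ ∞ (deriv (sw s)) := (contDiff_infty_iff_deriv.1 hsw).2
  have hV := isSmooth_V hδ
  show ContDiff ℝ ∞ fun p : ℝ × E3 => deriv (sw s) p.1 • lift (V δ) p.2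
      + (sw s p.1) ^ 2 • lift (convect (V δ) (V δ)) p.2 - (ν * sw s p.1) • lift (laplacian (V δ)) p.2
  exact (((hd.comp contDiff_fst).smul (hV.comp contDiff_snd)).add
    (((hsw.comp contDiff_fst).pow 2).smul ((hV.convect hV).comp contDiff_snd))).sub
    ((contDiff_const.mul (hsw.comp contDiff_fst)).smul (hV.laplacian.comp contDiff_snd))

/-- The witness is a global Leray–Hopf solution for its own (smooth) force. -/
theorem isGlobalLerayHopf_vel (ν : ℝ) (hδ : 0 < δ) (hδ' : δ < 1 / 2) (s : ℝ) :
    Literature.Analysis.FluidPDE.Torus.IsGlobalLerayHopf ν (force ν δ s) (vel δ s 0) (vel δ s) :=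
  (isClassicalNSSolutionOn_vel ν hδ hδ' s).isGlobalLerayHopf

/-- Joint continuity of the force (from its closed form). [folklore] -/
theorem continuous_force_uncurry (ν : ℝ) (hδ : 0 < δ) (s : ℝ) : Continuous (uncurry (force ν δ s)) := by
  rw [force_eq ν hδ s]
  have hV := isSmooth_V hδ
  have hsw := contDiff_sw s
  have hd : Continuous (deriv (sw s)) := (contDiff_infty_iff_deriv.1 hsw).2.continuous
  show Continuous fun p : ℝ × T3 => deriv (sw s) p.1 • V δ p.2
      + (sw s p.1) ^ 2 • convect (V δ) (V δ) p.2 - (ν * sw s p.1) • laplacian (V δ) p.2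
  exact (((hd.comp continuous_fst).smul (hV.continuous.comp continuous_snd)).add
    (((hsw.continuous.comp continuous_fst).pow 2).smul
      ((hV.convect hV).continuous.comp continuous_snd))).sub
    ((continuous_const.mul (hsw.continuous.comp continuous_fst)).smul
      (hV.laplacian.continuous.comp continuous_snd))

end Summit.NavierStokesRegularity.NavierStokesRegularity.Theorems.Tibola2025

end
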